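import Summits.BirchSwinnertonDyer.Rank1Residual.X11b.CharacterSupply
import Literature.NumberTheory.EllipticCurves.BDPAnticyclotomicPAdicLFunctionSigmaInt
import HarnessLib

/-!
# Route `UniversalToricDescent`, ♭B column (♭B′ `TwinWanFrameAtThreeMultTresT`, stmt-BirchSwinnertonDyer-27401), line `membertower` v10:
# RIGIDITY AT FIXED PERIODS of the typed weight-`k` Σ-imprimitive frames `IsBDPLFunctionWtSigmaInt` over `𝓞_{ℂ_p}⟦T⟧` —
# two `Q, Q'` with the same frame data are EQUAL (odd `p`, `K` imaginary quadratic, `κ` anticyclotomic with generator `γ`)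

Cell `bsd-wall` (run/shared/lean/pub/bsd-wall/), width seat `bsd-wall-utd-p2-w2` (g4, 2026-08-28), for the LEAD `bsd-wall-utd-p2` (g13) whose
skeleton v10 on ♭B′ types the member data against `IsBDPLFunctionWtSigmaInt ι′ 𝔭 κ γ D.g Σ Ω_K Ω_p Q_m` and whose research stub
`stub_memberRationalInclusionAtThree` quantifies over EVERY Σ-frame `(Ω_K, Ω_p, Q)` of the member (memo HOME/bsd-wall-utd-p2/MEMBER-TOWER-V10-g13
§3, §5 «refuter: junk audit of `IsBDPLFunctionWtSigmaInt` at `p = 3`»). This file is the constructive half of that audit AT FIXED PERIODS: the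
weight-`k`, Σ-imprimitive twin of the tree's weight-2 `X11b.R1.isBDPLFunctionInt_unique(_of_tendsto)` (BDPFrameUniquenessInt / CharacterSupply).
`--supports stmt-BirchSwinnertonDyer-27401 --as helper`; Theses-free; no named fact.

* `isBDPLFunctionWtSigmaInt_unique_of_tendsto` — given a supply `(φ_j, n_j, r_j)` of everywhere-unramified characters of infinity type
  `(n_j, −n_j)` with `k/2 ≤ n_j`, avatars through `κ`, `φ̂_j(γ) → 1`, `φ̂_j(γ) ≠ 1` frequently: two frames coincide (the prescribed values
  agree at `x_j = φ̂_j(γ) − 1 → 0`; `R1.intSeries_eq_of_hasValueAt`).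
* `isBDPLFunctionWtSigmaInt_unique` — UNCONDITIONAL at odd `p`: the supply is `X11b.characterSupplyAt` (`n_j = m·p^j`) SHIFTED past the
  weight (`m·p^{j+J} ≥ p^J > J ≥ k/2` for `J = k.toNat`).
* `isBDPLFunctionWtSigmaInt_forall_of_exists` — «some `Q` of the frame» = «every `Q` of the frame» (fixed periods): a `∀ Q`-quantified
  clause over a fixed-period frame costs exactly one `Q`.

HONEST FRAMING: elementary `p`-adic analysis assembled from tree theorems; CROSS-period rigidity (different `Ω_K, Ω_p`) is NOT claimed here;
no statement item is closed; BSD is proved for no curve.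
References: [Castella2020JIMJ] Thm. 2.11 (the weight-`k` interpolation); [JetchevSkinnerWan2017] §5.1 (Σ-imprimitive values);
[Castella2018] Thm. 3.1; [Gouvea1993PadicNumbers] §5.6 Cor. 5.6.3–4 (identity principle); [Washington1997] §5.1, §13.1.
-/

set_option autoImplicit false

noncomputable section

open scoped Classical

open Filter Topology NumberField IsDedekindDomain
  Literature.NumberTheory.EllipticCurves Literature.NumberTheory.GaloisRepresentations

namespace Summit.BirchSwinnertonDyer.Rank1Residual.X11b

variable {p : ℕ} [Fact p.Prime] {K : Type} [Field K] [NumberField K] {M : ℕ} {k : ℤ}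
  {ι : PadicAlgCl p ≃+* ℂ} {𝔭 : HeightOneSpectrum (𝓞 K)} {κ : ZpExtension K p} {γ : Field.absoluteGaloisGroup K}
  {g : CuspForm (CongruenceSubgroup.Gamma0 M) k} {S : Finset (HeightOneSpectrum (𝓞 K))} {ΩK : ℂ} {Ωp : ℂ_[p]}

/-- **Weight-`k` Σ-frame rigidity at fixed periods, given a character supply.** Two `Q, Q' ∈ 𝓞_{ℂ_p}⟦T⟧` with the same data
`IsBDPLFunctionWtSigmaInt ι 𝔭 κ γ g S Ω_K Ω_p ·` are EQUAL, given everywhere-unramified characters `φ_j` of infinity type `(n_j, −n_j)` with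
`k/2 ≤ n_j`, `p`-adic avatars `r_j` through `κ`, `φ̂_j(γ) → 1` and `φ̂_j(γ) ≠ 1` frequently (both series take the prescribed value at
`x_j = φ̂_j(γ) − 1 → 0`). [cite: Castella2020JIMJ, Thm. 2.11] [cite: JetchevSkinnerWan2017, §5.1 (arXiv:1512.06894 tex p0022 L41–50)]
[cite: Gouvea1993PadicNumbers, §5.6 Cor. 5.6.4] -/
theorem isBDPLFunctionWtSigmaInt_unique_of_tendsto {Q Q' : PowerSeries 𝓞_ℂ_[p]}
    (hQ : IsBDPLFunctionWtSigmaInt ι 𝔭 κ γ g S ΩK Ωp Q) (hQ' : IsBDPLFunctionWtSigmaInt ι 𝔭 κ γ g S ΩK Ωp Q')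
    {φ : ℕ → HeckeCharacter K} {n : ℕ → ℕ} {r : ℕ → FramedGaloisRep K (PadicAlgCl p) 1}
    (hn : ∀ j, k / 2 ≤ (n j : ℤ)) (hunr : ∀ j (v : HeightOneSpectrum (𝓞 K)), (φ j).IsUnramifiedAt v)
    (hinf : ∀ j, (φ j).HasInfinityType (fun _ ↦ (n j : ℤ)) (fun _ ↦ -(n j : ℤ)))
    (hr : ∀ j, IsPAdicAvatarOf ι (φ j) (r j)) (hκ : ∀ j, FactorsThroughZp κ (r j))
    (hlim : Tendsto (fun j ↦ avatarValueAt (r j) γ) atTop (𝓝 1))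
    (hne : ∃ᶠ j in atTop, avatarValueAt (r j) γ ≠ 1) : Q = Q' := by
  refine R1.intSeries_eq_of_hasValueAt (x := fun j ↦ avatarValueAt (r j) γ - 1)
    (v := fun j ↦ ((ι.symm (bdpInterpolationValueWtSigma p g 𝔭 (φ j) S (n j) ΩK) : PadicAlgCl p) : ℂ_[p]) *
      Ωp ^ (4 * n j)) ?_ ?_
    (fun j ↦ hQ (φ j) (n j) (hn j) (hunr j) (hinf j) (r j) (hr j) (hκ j))
    (fun j ↦ hQ' (φ j) (n j) (hn j) (hunr j) (hinf j) (r j) (hr j) (hκ j))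
  · rw [← sub_self (1 : ℂ_[p])]
    exact hlim.sub_const 1
  · exact hne.mono fun j hj ↦ sub_ne_zero.mpr hj

/-- **Weight-`k` Σ-frame rigidity at fixed periods, UNCONDITIONAL at odd `p`**: `K` imaginary quadratic, `κ` anticyclotomic with
topological generator `γ`; two `Q, Q' ∈ 𝓞_{ℂ_p}⟦T⟧` with the same data `IsBDPLFunctionWtSigmaInt ι 𝔭 κ γ g S Ω_K Ω_p ·` coincide. The
supply is `characterSupplyAt` (`φ₀^{p^j}`, infinity type `(m p^j, −m p^j)`) shifted by `J = k.toNat` so that `m·p^{j+J} ≥ k/2`.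
[cite: Castella2020JIMJ, Thm. 2.11] [cite: Washington1997, §13.1] [cite: Gouvea1993PadicNumbers, §5.6 Cor. 5.6.4] -/
theorem isBDPLFunctionWtSigmaInt_unique (hp2 : p ≠ 2) (hK : IsImaginaryQuadratic K) (hκ : κ.IsAnticyclotomic)
    (hγ : κ.IsTopGenerator γ) {Q Q' : PowerSeries 𝓞_ℂ_[p]}
    (hQ : IsBDPLFunctionWtSigmaInt ι 𝔭 κ γ g S ΩK Ωp Q) (hQ' : IsBDPLFunctionWtSigmaInt ι 𝔭 κ γ g S ΩK Ωp Q') :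
    Q = Q' := by
  have hp : p.Prime := Fact.out
  obtain ⟨m, x₀, φ, -, r, -, hm, hne, hlim, hunr, hinf, hav, hfac, hval, -⟩ :=
    characterSupplyAt hp2 K ι κ γ hK hκ hγ
  -- shift the supply past the weight: `n_j := m · p^(j + J)` with `J := k.toNat`
  set J : ℕ := k.toNat with hJ
  have hnJ : ∀ j : ℕ, k / 2 ≤ ((m * p ^ (j + J) : ℕ) : ℤ) := by
    intro j
    have h1 : J < p ^ J := Nat.lt_pow_self hp.one_lt
    have h2 : p ^ J ≤ p ^ (j + J) := Nat.pow_le_pow_right hp.pos (Nat.le_add_left J j)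
    have h3 : p ^ (j + J) ≤ m * p ^ (j + J) := Nat.le_mul_of_pos_left _ hm
    have h4 : (J : ℤ) < ((m * p ^ (j + J) : ℕ) : ℤ) := by exact_mod_cast h1.trans_le (h2.trans h3)
    omega
  refine isBDPLFunctionWtSigmaInt_unique_of_tendsto hQ hQ' (φ := fun j ↦ φ (j + J)) (n := fun j ↦ m * p ^ (j + J))
    (r := fun j ↦ r (j + J)) hnJ (fun j v ↦ hunr (j + J) v) (fun j ↦ hinf (j + J)) (fun j ↦ hav (j + J))
    (fun j ↦ hfac (j + J)) ?_ (Frequently.of_forall fun j ↦ ?_)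
  · have h := (hlim.comp (tendsto_add_atTop_nat J))
    refine h.congr fun j ↦ ?_
    simp only [Function.comp_apply, hval]
  · rw [hval]
    exact hne (j + J)

/-- **«Some `Q` of the Σ-frame» = «every `Q` of the Σ-frame» at fixed periods** (odd `p`, `K` imaginary quadratic, `κ` anticyclotomic,
`γ` a topological generator): a property holding for ONE `Q` with `IsBDPLFunctionWtSigmaInt ι 𝔭 κ γ g S Ω_K Ω_p Q` holds for EVERY such
`Q` — a `∀ Q`-quantified clause over a fixed-period frame (v10's `stub_memberRationalInclusionAtThree`) costs exactly one `Q`.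
[cite: Castella2020JIMJ, Thm. 2.11] [cite: JetchevSkinnerWan2017, §5.1 (arXiv:1512.06894 tex p0022 L41–50)] -/
theorem isBDPLFunctionWtSigmaInt_forall_of_exists (hp2 : p ≠ 2) (hK : IsImaginaryQuadratic K) (hκ : κ.IsAnticyclotomic)
    (hγ : κ.IsTopGenerator γ) {P : PowerSeries 𝓞_ℂ_[p] → Prop}
    (hex : ∃ Q, IsBDPLFunctionWtSigmaInt ι 𝔭 κ γ g S ΩK Ωp Q ∧ P Q) {Q' : PowerSeries 𝓞_ℂ_[p]}
    (hQ' : IsBDPLFunctionWtSigmaInt ι 𝔭 κ γ g S ΩK Ωp Q') : P Q' := by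
  obtain ⟨Q, hQ, hP⟩ := hex
  rwa [isBDPLFunctionWtSigmaInt_unique hp2 hK hκ hγ hQ hQ'] at hP

end Summit.BirchSwinnertonDyer.Rank1Residual.X11b

end
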